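import Mathlib.Algebra.Polynomial.Coeff
import Mathlib.Algebra.Polynomial.BigOperators
import Mathlib.FieldTheory.Finiteness
import Literature.InformationTheory.QuantumCodes.WeightEnumeratorBounds
import HarnessLib

/-!
# The MacWilliams identity for additive quantum codes and the CRSS linear-programming bound (proofs)

Topic `Literature/InformationTheory/QuantumCodes` (venture QEC, cell `qec`, PARTITION v2.4 item 06.LPK, proof half;
LADDER-QEC rung X1 «LP/shadow upper bounds per (n,k)»). THEOREMS ONLY — no new definitions; this file DISCHARGES the
named fact `CRSS1998_theorem21_LP` of `WeightEnumeratorBounds.lean` (Calderbank–Rains–Shor–Sloane, *Quantum error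
correction via codes over GF(4)*, IEEE Trans. Inform. Theory 44 (1998) 1369–1387 = arXiv:quant-ph/9608006, §7
Theorem 21, eqs. (16)–(21)): the weight distribution `A_j = #{v ∈ S̄ : wt v = j}` of an `[[n,k,d]]` additive
(stabilizer) code `S̄ ≤ Ē = 𝔽₂²ⁿ` (binary symplectic language of `SymplecticCodes.lean`: `SympVec`, `sympInner`,
`sympWeight`, `sympDual`, `IsAdditiveCode`) with no weight-1 element solves CRSS's linear system `CRSSLPFeasible n k d`.
Consequence for the census: every kernel certificate `¬ CRSSLPFeasible n k d` (the venture's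
`Summits/Ventures/QEC/Census/LPCertificate.lean`, `LPBounds/*.lean`) is now an UNCONDITIONAL nonexistence theorem.

Route of proof (the classical engine `Literature/InformationTheory/Coding/{DelsarteLPBound, MacWilliamsIdentity}.lean`
transposed from `𝔽₂ⁿ` with the dot product to `𝔽₂²ⁿ` with the symplectic form):
1. `coeff_krawtchouk4Gen`: `[X^j] (1 − X)^r (1 + 3X)^{n−r} = P_j(r,n)` (`krawtchouk4`, the QUATERNARY Krawtchouk
   polynomial).
2. `sum_negOnePow_sympInner_mul_X_pow`: for `v` of weight `r`, `Σ_w (−1)^{(v,w)} X^{wt w} = (1 − X)^r (1 + 3X)^{n−r}`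
   (product over the qubits of the one-qubit sums `sum_local_character`: the identity commutes with all four Paulis,
   a non-identity Pauli commutes with two and anticommutes with two), whence the quaternary Delsarte lemma
   `sum_negOnePow_sympInner_eq_krawtchouk4`: `Σ_{wt w = j} (−1)^{(v,w)} = P_j(wt v, n)`.
3. Character orthogonality on a subspace (`sum_negOnePow_sympInner_of_mem_sympDual` / `_of_not_mem_sympDual`) and the
   MacWilliams identity for the symplectic dual `card_mul_dualWeightCount_eq`:
   `|S̄| · #{w ∈ S̄⊥ : wt w = j} = Σ_r P_j(r,n) A_r` — eq. (18), valid for EVERY subspace `S̄ ≤ Ē`.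
4. Weight parity `natCast_sympWeight_add`: `wt(u+v) ≡ wt u + wt v + (u,v) (mod 2)`; hence on a self-orthogonal `S̄`
   the even-weight vectors form a subspace `C′` (`exists_evenSubmodule`) of index `≤ 2` (`two_mul_card_even_eq_or`)
   — eq. (20); the MacWilliams identity for `C′` with `S̄⊥ ⊆ C′⊥` gives (21).
5. `CRSS1998_theorem21_LP_holds` assembles (16)–(21) (with `|S̄| = 2^{n−k}`, `card_filter_mem_eq_two_pow_finrank`).
Steps 1–3 are THIS file; steps 4–5 (weight parity, even subcode, the assembly of Theorem 21) are the companion file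
`AdditiveLPBound.lean` (split at the 400-line cap; same author, same session).

Deliberately NOT here: Rains's operator-level enumerators and the general-code LP bound `Rains1999_LPBound` (Thms. 1–8,
10 of Rains 1999 — a different, analytic proof for `((n,K,d))`); the shadow DISTANCE bounds (Rains 1998 Thms. 6, 9);
LP optimal values (certificates, not theorems). Mathlib/tree search: `lean search 'krawtchouk4|MacWilliams|sympDual'`
— the binary MacWilliams/Delsarte engine exists under `Literature.InformationTheory.Coding` (binary `krawtchouk`,
`signChar`); no quaternary/symplectic version existed (2026-08-26). Column words: proved (every declaration).

References: [CalderbankEtAl1998] as above, §2 eq. (1) (symplectic inner product, weight), §7 Thm. 21; [Rains1999Shadow]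
E. M. Rains, *Quantum shadow enumerators*, IEEE Trans. Inform. Theory 45 (1999) 2361–2366, Thm. 10 (the polynomials
`P_i(x,n)`). Locator custody: qec-lit-4 / qec-type-06 (`run/shared/lean/pub/qec/lit/LIT-4-REGISTER.md` §B).
-/

namespace Literature.InformationTheory.QuantumCodes

open Finset Polynomial

/-! ### 1. Generating function of the quaternary Krawtchouk polynomials -/

/-- Binomial coefficient extraction: the coefficient of `X^a` in `(1 − X)^x` is `(−1)^a C(x,a)`.
[cite: CalderbankEtAl1998, §7 before Thm. 21 (Krawtchouk polynomials P_j(x,n))] -/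
theorem coeff_one_sub_X_pow_eq (x a : ℕ) :
    (((1 : ℤ[X]) - X) ^ x).coeff a = (-1) ^ a * (x.choose a : ℤ) := by
  have h1 : ((1 : ℤ[X]) - X) = C (-1) * (X + C (-1)) := by
    simp only [map_neg, C_1, neg_mul, one_mul, neg_add_rev, neg_neg]
    ring
  rw [h1, mul_pow, ← C_pow, coeff_C_mul, coeff_X_add_C_pow]
  by_cases hax : a ≤ x
  · obtain ⟨b, rfl⟩ := Nat.exists_eq_add_of_le hax
    rw [Nat.add_sub_cancel_left, pow_add]
    have hb : ((-1 : ℤ) ^ b) * (-1) ^ b = 1 := by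
      rw [← pow_add, ← two_mul, pow_mul, neg_one_sq, one_pow]
    linear_combination ((-1 : ℤ) ^ a * ((a + b).choose a : ℤ)) * hb
  · rw [Nat.choose_eq_zero_of_lt (lt_of_not_ge hax)]
    simp

/-- Binomial coefficient extraction: the coefficient of `X^b` in `(1 + 3X)^m` is `3^b C(m,b)`.
[cite: CalderbankEtAl1998, §7 before Thm. 21 (Krawtchouk polynomials P_j(x,n))] -/
theorem coeff_one_add_three_X_pow_eq (m b : ℕ) :
    (((1 : ℤ[X]) + C 3 * X) ^ m).coeff b = 3 ^ b * (m.choose b : ℤ) := by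
  rw [add_comm, add_pow, finsetSum_coeff]
  have hterm : ∀ i ∈ range (m + 1),
      ((C (3 : ℤ) * X) ^ i * 1 ^ (m - i) * (m.choose i : ℤ[X])).coeff b
        = if b = i then 3 ^ i * (m.choose i : ℤ) else 0 := by
    intro i _
    have hi : (C (3 : ℤ) * X) ^ i * 1 ^ (m - i) * (m.choose i : ℤ[X])
        = C (3 ^ i * (m.choose i : ℤ)) * X ^ i := by
      rw [map_mul, map_pow, map_natCast, one_pow, mul_one, mul_pow]
      ring
    rw [hi, coeff_C_mul_X_pow]
  rw [sum_congr rfl hterm, sum_ite_eq]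
  split_ifs with hb
  · rfl
  · rw [mem_range, not_lt] at hb
    rw [Nat.choose_eq_zero_of_lt (by omega)]
    simp

/-- **Generating function of the quaternary Krawtchouk polynomials**: the coefficient of `X^j` in
`(1 − X)^r (1 + 3X)^{n−r}` is `P_j(r,n) = Σ_s (−1)^s 3^{j−s} C(r,s) C(n−r,j−s)` (`krawtchouk4 n j r`).
[cite: CalderbankEtAl1998, §7 before Thm. 21 (Krawtchouk polynomials P_j(x,n)); Rains1999Shadow, Thm. 10 p. 2364] -/
theorem coeff_krawtchouk4Gen (n j r : ℕ) :
    ((((1 : ℤ[X]) - X) ^ r * (1 + C 3 * X) ^ (n - r)).coeff j) = krawtchouk4 n j r := by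
  rw [coeff_mul, Finset.Nat.sum_antidiagonal_eq_sum_range_succ_mk, krawtchouk4]
  refine Finset.sum_congr rfl fun s _ => ?_
  rw [coeff_one_sub_X_pow_eq, coeff_one_add_three_X_pow_eq]
  ring

/-! ### 2. The symplectic characters `(−1)^{(v,w)}` -/

/-- `(−1)^{a+b} = (−1)^a (−1)^b` for `a, b ∈ 𝔽₂` (integer signs). [folklore] -/
private theorem negOnePow_val_add_int (a b : ZMod 2) :
    (-1 : ℤ) ^ (a + b).val = (-1) ^ a.val * (-1) ^ b.val := by
  revert a b; decide

/-- `(−1)^{Σᵢ fᵢ} = ∏ᵢ (−1)^{fᵢ}` over `𝔽₂` (integer signs). [folklore] -/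
private theorem negOnePow_val_sum_int {ι : Type*} (s : Finset ι) (f : ι → ZMod 2) :
    (-1 : ℤ) ^ (∑ i ∈ s, f i).val = ∏ i ∈ s, (-1 : ℤ) ^ (f i).val := by
  classical
  induction s using Finset.cons_induction with
  | empty => simp
  | cons i s hi ih => rw [sum_cons, prod_cons, negOnePow_val_add_int, ih]

/-- `(−1)^a = −1` for `a ≠ 0` in `𝔽₂`. [folklore] -/
private theorem negOnePow_val_of_ne_zero {a : ZMod 2} (h : a ≠ 0) : (-1 : ℤ) ^ a.val = -1 := by
  revert a; decide

variable {n : ℕ}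

/-- The symplectic inner product written as a single sum over the qubits:
`((a|b),(a′|b′)) = Σᵢ (aᵢ b′ᵢ + a′ᵢ bᵢ)`. [cite: CalderbankEtAl1998, §2 eq. (1) (printed p. 4)] -/
theorem sympInner_eq_sum (v w : SympVec n) :
    sympInner v w = ∑ i, (v.1 i * w.2 i + w.1 i * v.2 i) := by
  simp only [sympInner, dotProduct, ← Finset.sum_add_distrib]

/-- The symplectic character factorises over the qubits:
`(−1)^{(v,w)} = ∏ᵢ (−1)^{vᵢ·wᵢ}` (local symplectic products).
[cite: CalderbankEtAl1998, §2 eq. (1) (printed p. 4)] -/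
theorem negOnePow_sympInner_eq_prod (v w : SympVec n) :
    (-1 : ℤ) ^ (sympInner v w).val = ∏ i, (-1 : ℤ) ^ (v.1 i * w.2 i + w.1 i * v.2 i).val := by
  rw [sympInner_eq_sum, negOnePow_val_sum_int]

/-- Multiplicativity of the symplectic character in the first argument:
`(−1)^{(u+v,w)} = (−1)^{(u,w)} (−1)^{(v,w)}`. [cite: CalderbankEtAl1998, §2 eq. (1) (printed p. 4: bilinearity)] -/
theorem negOnePow_sympInner_add_left (u v w : SympVec n) :
    (-1 : ℤ) ^ (sympInner (u + v) w).val
      = (-1) ^ (sympInner u w).val * (-1) ^ (sympInner v w).val := by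
  rw [sympInner_add_left, negOnePow_val_add_int]

/-! ### 3. The quaternary Delsarte lemma -/

/-- The one-qubit character sum: `Σ_{x ∈ 𝔽₂²} (−1)^{((a,b),x)} X^{wt x}` equals `1 + 3X` if
`(a,b) = (0,0)` (the identity commutes with `I, X, Y, Z`) and `1 − X` otherwise (a non-identity
Pauli commutes with itself and the identity and anticommutes with the other two).
[cite: CalderbankEtAl1998, §2 (printed p. 4, the symplectic inner product (1)); §7 Thm. 21 eq. (18)] -/
theorem sum_local_character (a b : ZMod 2) :
    ∑ x : ZMod 2 × ZMod 2,
        C ((-1 : ℤ) ^ (a * x.2 + x.1 * b).val) * X ^ (if x.1 ≠ 0 ∨ x.2 ≠ 0 then 1 else 0)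
      = if a = 0 ∧ b = 0 then (1 : ℤ[X]) + C 3 * X else 1 - X := by
  have huniv : (univ : Finset (ZMod 2 × ZMod 2)) = {(0, 0), (0, 1), (1, 0), (1, 1)} := by
    decide
  have ha : a = 0 ∨ a = 1 := by revert a; decide
  have hb : b = 0 ∨ b = 1 := by revert b; decide
  have h11 : (1 : ZMod 2) + 1 = 0 := by decide
  have hv1 : ((1 : ZMod 2)).val = 1 := rfl
  have hv0 : ((0 : ZMod 2)).val = 0 := rfl
  rw [huniv, sum_insert (by decide), sum_insert (by decide), sum_insert (by decide),
    sum_singleton]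
  rcases ha with rfl | rfl <;> rcases hb with rfl | rfl <;>
    simp [h11, hv1, hv0] <;> ring

/-- **The weight-enumerator generating polynomial of a symplectic character**: for `v ∈ Ē` of
weight `r`, `Σ_{w ∈ Ē} (−1)^{(v,w)} X^{wt w} = (1 − X)^r (1 + 3X)^{n−r}` (product over the qubits
of the one-qubit sums `sum_local_character`).
[cite: CalderbankEtAl1998, §7 Thm. 21 eq. (18) (the MacWilliams transform with P_j(r,n))] -/
theorem sum_negOnePow_sympInner_mul_X_pow (v : SympVec n) :
    ∑ w : SympVec n, C ((-1 : ℤ) ^ (sympInner v w).val) * X ^ sympWeight w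
      = ((1 : ℤ[X]) - X) ^ sympWeight v * (1 + C 3 * X) ^ (n - sympWeight v) := by
  classical
  let e : (Fin n → ZMod 2 × ZMod 2) ≃ SympVec n := Equiv.arrowProdEquivProdArrow _ _ _
  let f : Fin n → ZMod 2 × ZMod 2 → ℤ[X] := fun i x =>
    C ((-1 : ℤ) ^ (v.1 i * x.2 + x.1 * v.2 i).val) * X ^ (if x.1 ≠ 0 ∨ x.2 ≠ 0 then 1 else 0)
  -- Step 1: the sum over `Ē` is the sum over `𝔽₂²`-valued functions of a product over qubits.
  have h1 : ∑ w : SympVec n, C ((-1 : ℤ) ^ (sympInner v w).val) * X ^ sympWeight w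
      = ∑ p : Fin n → ZMod 2 × ZMod 2, ∏ i, f i (p i) := by
    rw [← Equiv.sum_comp e]
    refine Fintype.sum_congr _ _ fun p => ?_
    simp only [f]
    rw [prod_mul_distrib, ← map_prod]
    congr 1
    · rw [negOnePow_sympInner_eq_prod]; rfl
    · rw [prod_pow_eq_pow_sum, sum_boole]; rfl
  -- Step 2: product of the one-qubit sums.
  have h2 : (∑ p : Fin n → ZMod 2 × ZMod 2, ∏ i, f i (p i)) = ∏ i, ∑ x, f i x :=
    (Fintype.prod_sum f).symm
  have h3 : ∀ i, ∑ x, f i x = if v.1 i = 0 ∧ v.2 i = 0 then (1 : ℤ[X]) + C 3 * X else 1 - X :=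
    fun i => sum_local_character (v.1 i) (v.2 i)
  rw [h1, h2, prod_congr rfl fun i _ => h3 i, prod_ite, prod_const, prod_const, mul_comm]
  have hwt : #{i | ¬(v.1 i = 0 ∧ v.2 i = 0)} = sympWeight v := by
    unfold sympWeight
    exact congrArg card (filter_congr fun i _ => by rw [not_and_or])
  have hco : #{i | v.1 i = 0 ∧ v.2 i = 0} = n - sympWeight v := by
    have h := Finset.card_filter_add_card_filter_not (s := (univ : Finset (Fin n)))
      (fun i => v.1 i = 0 ∧ v.2 i = 0)
    rw [hwt, card_univ, Fintype.card_fin] at h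
    omega
  rw [hwt, hco]

/-- **Quaternary Delsarte lemma** (the combinatorial core of the MacWilliams identity for
additive codes): for `v ∈ Ē` and every `j`,
`Σ_{w ∈ Ē, wt w = j} (−1)^{(v,w)} = P_j(wt v, n)` — the character sum over the Pauli words of
weight `j` is the quaternary Krawtchouk value `krawtchouk4 n j (wt v)`.
[cite: CalderbankEtAl1998, §7 Thm. 21 eq. (18); Rains1999Shadow, Thm. 10 p. 2364 (P_i(x,n))] -/
theorem sum_negOnePow_sympInner_eq_krawtchouk4 (v : SympVec n) (j : ℕ) :
    ∑ w ∈ univ.filter (fun w : SympVec n => sympWeight w = j), (-1 : ℤ) ^ (sympInner v w).val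
      = krawtchouk4 n j (sympWeight v) := by
  classical
  have h := congrArg (fun P : ℤ[X] => P.coeff j) (sum_negOnePow_sympInner_mul_X_pow v)
  simp only [finsetSum_coeff, coeff_C_mul_X_pow, coeff_krawtchouk4Gen] at h
  rw [← h, Finset.sum_filter]
  refine sum_congr rfl fun w _ => ?_
  by_cases hw : sympWeight w = j
  · rw [if_pos hw, if_pos hw.symm]
  · rw [if_neg hw, if_neg (Ne.symm hw)]


/-! ### 4. Orthogonality of the symplectic characters on an additive code -/

section Code

variable (S : Submodule (ZMod 2) (SympVec n)) [DecidablePred (· ∈ S)]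

/-- **Character orthogonality, trivial character**: for `w ∈ S̄⊥` every `v ∈ S̄` has `(v,w) = 0`, so
`Σ_{v ∈ S̄} (−1)^{(v,w)} = |S̄|`. [cite: CalderbankEtAl1998, §7 Thm. 21 (proof: MacWilliams transform, their Thm. 5)] -/
theorem sum_negOnePow_sympInner_of_mem_sympDual {w : SympVec n} (hw : w ∈ sympDual S) :
    ∑ v ∈ univ.filter (· ∈ S), (-1 : ℤ) ^ (sympInner v w).val = #(univ.filter (· ∈ S)) := by
  rw [Finset.cast_card]
  refine sum_congr rfl fun v hv => ?_
  rw [(mem_sympDual_iff.1 hw) v (mem_filter.1 hv).2]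
  rfl

/-- **Character orthogonality, nontrivial character**: for `w ∉ S̄⊥` some `u ∈ S̄` has `(u,w) = 1`;
translating by `u` permutes `S̄` and flips every sign, so `Σ_{v ∈ S̄} (−1)^{(v,w)} = 0`.
[cite: CalderbankEtAl1998, §7 Thm. 21 (proof: MacWilliams transform, their Thm. 5)] -/
theorem sum_negOnePow_sympInner_of_not_mem_sympDual {w : SympVec n} (hw : w ∉ sympDual S) :
    ∑ v ∈ univ.filter (· ∈ S), (-1 : ℤ) ^ (sympInner v w).val = 0 := by
  obtain ⟨u, huS, hu⟩ : ∃ u ∈ S, sympInner u w ≠ 0 := by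
    by_contra h
    push Not at h
    exact hw (mem_sympDual_iff.2 h)
  set T := univ.filter (· ∈ S) with hT
  have hmem : ∀ v, v ∈ T ↔ u + v ∈ T := fun v => by
    simp only [hT, mem_filter, mem_univ, true_and]
    refine ⟨fun hv => S.add_mem huS hv, fun h => ?_⟩
    have h' := S.sub_mem h huS
    rwa [add_sub_cancel_left] at h'
  have key : ∑ v ∈ T, (-1 : ℤ) ^ (sympInner (u + v) w).val
      = ∑ v ∈ T, (-1 : ℤ) ^ (sympInner v w).val :=
    Finset.sum_equiv (Equiv.addLeft u) (fun v => hmem v) (fun v _ => rfl)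
  have hneg : ∑ v ∈ T, (-1 : ℤ) ^ (sympInner (u + v) w).val
      = -∑ v ∈ T, (-1 : ℤ) ^ (sympInner v w).val := by
    rw [← sum_neg_distrib]
    refine sum_congr rfl fun v _ => ?_
    rw [negOnePow_sympInner_add_left, negOnePow_val_of_ne_zero hu]
    ring
  linarith

/-! ### 5. The MacWilliams identity for the symplectic dual -/

/-- **MacWilliams identity for additive codes (Krawtchouk form, cleared of the denominator)**:
for every subspace `S̄ ≤ Ē = 𝔽₂²ⁿ` and every `j`,
`|S̄| · #{w ∈ S̄⊥ : wt w = j} = Σ_{v ∈ S̄} P_j(wt v, n)`,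
i.e. the weight distribution of the symplectic dual is the quaternary Krawtchouk (MacWilliams)
transform of that of `S̄` — eq. (18) of CRSS Thm. 21 (their Thm. 5 under the `GF(4)` dictionary).
Proof: Delsarte lemma `sum_negOnePow_sympInner_eq_krawtchouk4` + character orthogonality.
[cite: CalderbankEtAl1998, §7 Thm. 21 eq. (18) (A′_j = 2^{−(n−k)} Σ_r P_j(r,n) A_r)] -/
theorem card_mul_card_sympDual_filter_eq_sum_krawtchouk4 [DecidablePred (· ∈ sympDual S)] (j : ℕ) :
    (#(univ.filter (· ∈ S)) : ℤ) * #{w : SympVec n | w ∈ sympDual S ∧ sympWeight w = j}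
      = ∑ v ∈ univ.filter (· ∈ S), krawtchouk4 n j (sympWeight v) := by
  symm
  calc ∑ v ∈ univ.filter (· ∈ S), krawtchouk4 n j (sympWeight v)
      = ∑ v ∈ univ.filter (· ∈ S), ∑ w ∈ univ.filter (fun w : SympVec n => sympWeight w = j),
          (-1 : ℤ) ^ (sympInner v w).val :=
        sum_congr rfl fun v _ => (sum_negOnePow_sympInner_eq_krawtchouk4 v j).symm
    _ = ∑ w ∈ univ.filter (fun w : SympVec n => sympWeight w = j), ∑ v ∈ univ.filter (· ∈ S),
          (-1 : ℤ) ^ (sympInner v w).val := sum_comm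
    _ = ∑ w ∈ univ.filter (fun w : SympVec n => sympWeight w = j),
          (if w ∈ sympDual S then (#(univ.filter (· ∈ S)) : ℤ) else 0) := by
        refine sum_congr rfl fun w _ => ?_
        split_ifs with h
        · exact sum_negOnePow_sympInner_of_mem_sympDual S h
        · exact sum_negOnePow_sympInner_of_not_mem_sympDual S h
    _ = (#(univ.filter (· ∈ S)) : ℤ) * #{w : SympVec n | w ∈ sympDual S ∧ sympWeight w = j} := by
        have hf : (univ.filter (fun w : SympVec n => sympWeight w = j)).filter (· ∈ sympDual S)
            = univ.filter (fun w : SympVec n => w ∈ sympDual S ∧ sympWeight w = j) := by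
          ext w
          simp only [mem_filter, mem_univ, true_and]
          exact and_comm
        rw [← sum_filter, hf, sum_const, nsmul_eq_mul, mul_comm]

/-- **Krawtchouk sums regrouped by weight**: `Σ_{v ∈ S̄} P_j(wt v, n) = Σ_{r=0}^{n} P_j(r,n) A_r`
with `A_r = #{v ∈ S̄ : wt v = r}` the weight distribution of `S̄` (weights are `≤ n`).
[cite: CalderbankEtAl1998, §7 Thm. 21 eq. (18)] -/
theorem sum_krawtchouk4_eq_sum_range (j : ℕ) :
    ∑ v ∈ univ.filter (· ∈ S), krawtchouk4 n j (sympWeight v)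
      = ∑ r ∈ range (n + 1), krawtchouk4 n j r * #{v : SympVec n | v ∈ S ∧ sympWeight v = r} := by
  rw [← sum_fiberwise_of_maps_to (s := univ.filter (· ∈ S)) (t := range (n + 1))
    (g := fun v => sympWeight v) (fun v _ => mem_range.2 (Nat.lt_succ_of_le (sympWeight_le v)))]
  refine sum_congr rfl fun r _ => ?_
  rw [sum_congr rfl fun v hv => by rw [(mem_filter.1 hv).2], sum_const, nsmul_eq_mul, mul_comm,
    filter_filter]

/-- **MacWilliams identity, weight-distribution form** (CRSS eq. (18) cleared of `2^{−(n−k)}`):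
`|S̄| · A′_j = Σ_{r=0}^{n} P_j(r,n) A_r`, where `A_r = #{v ∈ S̄ : wt v = r}` and
`A′_j = #{w ∈ S̄⊥ : wt w = j}`. [cite: CalderbankEtAl1998, §7 Thm. 21 eq. (18)] -/
theorem card_mul_dualWeightCount_eq [DecidablePred (· ∈ sympDual S)] (j : ℕ) :
    (#(univ.filter (· ∈ S)) : ℤ) * #{w : SympVec n | w ∈ sympDual S ∧ sympWeight w = j}
      = ∑ r ∈ range (n + 1), krawtchouk4 n j r * #{v : SympVec n | v ∈ S ∧ sympWeight v = r} := by
  rw [card_mul_card_sympDual_filter_eq_sum_krawtchouk4, sum_krawtchouk4_eq_sum_range]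

end Code

end Literature.InformationTheory.QuantumCodes
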